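import Summits.NavierStokesRegularity.NavierStokesRegularity.Theses.TerminalTrace
import Summits.NavierStokesRegularity.NavierStokesRegularity.Theses.TypeILiouville
import Summits.NavierStokesRegularity.NavierStokesRegularity.Theorems.TypeILiouvilleLKillsTypeI
import Summits.NavierStokesRegularity.NavierStokesRegularity.Theorems.AdaptedFrequencyAdaptedFrequencyConvergesOfTypeIAncientLiouville
import Summits.NavierStokesRegularity.NavierStokesRegularity.Theorems.TerminalTraceTypeITraceScarL3StubExtinctApexOfL3Trace
import Summits.NavierStokesRegularity.NavierStokesRegularity.Theorems.TerminalTraceTypeITraceScarL3StubLocalTypeIOfTypeIBlowup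
import HarnessLib

/-!
# Item `TerminalTrace.TypeITraceScarL3` (stmt-NavierStokesRegularity-18385): two by-name reductions —
# from the KNSS Liouville conjecture (L) by vacuity, and from the extinction Liouville statement (line
# `extinct-apex` with its Stubs 1–2 now tree theorems)

Seat ns-typeII-p3 g9 (cell ns-regularity-ideate), `--supports stmt-NavierStokesRegularity-18385`.  Both
theorems are CONDITIONAL on their displayed hypotheses; nothing here closes the item.

* `typeITraceScarL3_of_typeIliouvilleL` — the KNSS Liouville conjecture (L), in the form of the route item
  `TypeILiouville.TypeIliouvilleL` (stmt-NavierStokesRegularity-10661: every bounded ancient mild solution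
  with measurable slices is slice-wise a.e. constant), IMPLIES `TypeITraceScarL3` — by vacuity: under (L)
  a Type-I-in-time classical Leray–Hopf solution from a rapidly decaying datum extends smoothly past `T`
  (the tree's `typeIExtends_of_liouvilleConjectureNS`, route TypeILiouville item `TypeIliouvilleLKillsTypeI`),
  so no point `(T, x₀)` is backward singular (`not_backwardSingular_of_hasSmoothExtensionPast`), and the
  item's singular-vertex premise is contradictory.  (nsreg-p2 ROUND-25, T-25.4: the idle-prover corollary.)
* `typeITraceScarL3_of_no_extinctApex` — the composition of line `extinct-apex` with its two landed stubs
  (`stub_localTypeI_of_typeIBlowup`, nsreg-p4 g14 p576636; `stub_extinctApex_of_L3trace`, p581640): the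
  EXTINCTION LIOUVILLE statement (no extinct Type-I apex — an ancient pair suitable in every `Q(a)`,
  Type-I bounded at every scale, with the rate `C/√(−s)`, weakly vanishing at the top time, is not singular
  at the origin; Seregin 2014 p. 127, OPEN) IMPLIES `TypeITraceScarL3`.  This is the registered skeleton's
  `TypeITraceScarL3_of` with the `sorry`s of Stubs 1–2 replaced by the tree theorems, i.e. the kernel
  record that item 18385 is closed MODULO exactly its extinction-Liouville stub.

WHAT THIS IS NOT: not NS regularity, not item 18385 — two conditional reductions; the hypotheses ((L);
the extinction Liouville statement) are OPEN.  [folklore; KNSS2009 §6; AlbrittonBarker2019 §3; Seregin2014 §6.6]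
-/

noncomputable section

set_option linter.dupNamespace false

namespace Summit.NavierStokesRegularity.NavierStokesRegularity.Theorems.TypeITraceScarL3

open MeasureTheory Set Function Filter Topology Metric
open Literature.Analysis.FluidPDE
open scoped NNReal ENNReal InnerProductSpace RealInnerProductSpace

/-- **(L) ⇒ `TypeITraceScarL3`, by vacuity.**  If every bounded ancient mild solution of Navier–Stokes
(`ν = 1`) with measurable slices is slice-wise a.e. constant (the KNSS Liouville conjecture (L), item
`TypeILiouville.TypeIliouvilleL`), then a Type-I-in-time classical Leray–Hopf solution from a rapidly decaying
datum has no backward-singular point at `T` — it extends smoothly past `T` — so the Type-I cell of the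
terminal-trace scar holds with nothing to check. [folklore; KNSS2009 §1 and §6] -/
theorem typeITraceScarL3_of_typeIliouvilleL
    (hL : Summit.NavierStokesRegularity.NavierStokesRegularity.Theses.TypeILiouville.TypeIliouvilleL) :
    Summit.NavierStokesRegularity.NavierStokesRegularity.Theses.TerminalTrace.TypeITraceScarL3 := by
  intro ν T hν hT u p hcl hLH hdec hTI x₀ hsing ρ _ _
  exact AdaptedFrequencyConverges.CloudFrameEffectiveTsai.not_backwardSingular_of_hasSmoothExtensionPast hT
    (typeIExtends_of_liouvilleConjectureNS hL ν T hν hT u p hcl hLH hdec hTI) x₀ hsing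

/-- **The extinction Liouville statement ⇒ `TypeITraceScarL3`** (line `extinct-apex` composed with its
landed Stubs 1–2).  If no EXTINCT TYPE-I APEX exists — no pair `(U, P)` suitable in every parabolic ball
`Q(a)` at the space–time origin with a weak gradient `G`, Albritton–Barker bound `𝐈(Q(a)) ≤ M` at every
scale, the rate `‖U(s, y)‖ ≤ C/√(−s)` (a.e. `y`, every `s < 0`) and weakly vanishing at the top time can be
backward-singular at the origin — then a Type-I-in-time first singularity scars the terminal value out of
`L³` near every backward-singular point: assume an `L³` ball, produce the apex by `stub_extinctApex_of_L3trace`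
(fed with `stub_localTypeI_of_typeIBlowup`), contradict. [folklore; Seregin2014 §6.6 and p. 127 (the open
statement); AlbrittonBarker2019 §3] -/
theorem typeITraceScarL3_of_no_extinctApex
    (h₃ : ∀ (U : ℝ → EuclideanSpace ℝ (Fin 3) → EuclideanSpace ℝ (Fin 3)) (P : ℝ → EuclideanSpace ℝ (Fin 3) → ℝ)
      (G : ℝ → EuclideanSpace ℝ (Fin 3) → EuclideanSpace ℝ (Fin 3) →L[ℝ] EuclideanSpace ℝ (Fin 3))
      (M : ℝ≥0) (C : ℝ),
      (∀ a : ℝ, 0 < a → IsSuitableWeakSolutionInBall a (0 : ℝ × EuclideanSpace ℝ (Fin 3)) U P) →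
      (∀ a : ℝ, 0 < a →
        HasWeakSpatialGradientOn (parabolicCylinderOpens a (0 : ℝ × EuclideanSpace ℝ (Fin 3))) U G) →
      (∀ a : ℝ, 0 < a → typeIBound (parabolicCylinder a (0 : ℝ × EuclideanSpace ℝ (Fin 3))) U P G ≤ M) →
      (∀ s : ℝ, s < 0 → ∀ᵐ y : EuclideanSpace ℝ (Fin 3), ‖U s y‖ ≤ C / Real.sqrt (-s)) →
      (∀ φ : EuclideanSpace ℝ (Fin 3) → EuclideanSpace ℝ (Fin 3), ContDiff ℝ (⊤ : ℕ∞) φ →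
        HasCompactSupport φ → ∀ ε : ℝ, 0 < ε →
        ∃ s₀ : ℝ, s₀ < 0 ∧ ∀ᵐ s ∂(volume.restrict (Ioo s₀ 0)), |∫ y, ⟪U s y, φ y⟫| ≤ ε) →
      ¬ IsBackwardSingularPoint U (0 : ℝ × EuclideanSpace ℝ (Fin 3))) :
    Summit.NavierStokesRegularity.NavierStokesRegularity.Theses.TerminalTrace.TypeITraceScarL3 := by
  intro ν T hν hT u p hcl hLH _hdec hTI x₀ hsing ρ hρ hmem
  obtain ⟨U, P, G, M, C, hsw, hG, hI, hrate, htop, hsingU⟩ :=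
    stub_extinctApex_of_L3trace ν T hν hT u p hcl hLH hTI x₀
      (TerminalTraceTypeITraceScarL3StubLocalTypeIOfTypeIBlowup.stub_localTypeI_of_typeIBlowup
        ν T hν hT u p hcl hLH hTI x₀)
      hsing ⟨ρ, hρ, hmem⟩
  exact h₃ U P G M C hsw hG hI hrate htop hsingU

end Summit.NavierStokesRegularity.NavierStokesRegularity.Theorems.TypeITraceScarL3

end
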